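import Summits.BirchSwinnertonDyer.BirchSwinnertonDyer.Theorems.ErratumRoadFiveIMCDivTransferTwoRing
import Mathlib.RingTheory.KrullDimension.Regular
import Mathlib.RingTheory.KrullDimension.PID
import HarnessLib

/-!
# K2 crux 19270 `IMCDivAtErratumDataAll` (H3♭), ROAD FF — the «𝔪^k-trick»: the one-sided
# transfer WITHOUT the erratum's Lemma 2.2 ("no nonzero finite submodule" of `X_f`)

Cell `bsd-stepL`, seat `bsd-stepL-imc-p1` (g7). `--supports stmt-BirchSwinnertonDyer-19270 --as helper`.
HONEST FRAMING: BSD is not proved for any pair by this file; it closes no item; no definition, no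
named fact, no `sorry`. Sequel of `ErratumRoadFiveIMCDivTransferTwoRing.lean` (p470728).

## The point

The two-ring one-sided congruence limit (`CongruenceLimit.map_fittingIdeal_le_span_of_congruences`)
gives `Fitt_{Λ_𝒪}(X_f)·Λ^{ur} ⊆ (L_p(f))` from Hida's congruences (b), FW21's one inclusion for the
crystalline `g_m` and the `L`-function congruences (c) — with NO input on `X_f`. To reach the
printed currency `Ch_{Λ_𝒪}(X_f)·Λ^{ur} ⊆ (L_p(f))` the erratum (and the tree's end forms
`…_printed`, `powerSeries_charIdeal_le_span_of_selmer_congruences`, p470728 §1–§4) use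
`Fitt = Ch` for `X_f`, i.e. erratum Lemma 2.2 "no nonzero finite-index submodule" (`hnf`), whose
printed support at ERRATUM data is thin: [HL19, Prop. 3.12] assumes `N̄⁻ = 1`, `(D_K, N̄) = 1`, and
the verification of [Gre16, Prop. 4.1.1]'s hypotheses RFX ∕ LEO ∕ LOC ∕ CRK at erratum data is not
in print (lit g14, LIT-DOSSIER §20.7 ∕ §20.10 (γ): "avoid F6"). THIS FILE REMOVES `hnf`: for a
finite TORSION module `M` over `Λ_𝒪 = 𝒪⟦T⟧` (`𝒪` a DVR) and the coefficient extension
`φ = 𝒪⟦T⟧ → 𝒪'⟦T⟧` along an injective `ι : 𝒪 → 𝒪'` (`𝒪'` a PID, e.g. `𝒪^{ur}`),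

  `Fitt_{Λ_𝒪}(M)·𝒪'⟦T⟧ ⊆ (L)  ⟹  Ch_{Λ_𝒪}(M)·𝒪'⟦T⟧ ⊆ (L)`      (`map_charIdeal_le_span_of_map_fittingIdeal_le`).

Proof ("𝔪^k-trick", PROOF-BDP §13 Thm. B′ step (3), here kernel-checked): write `Ch(M) = (c)`;
`Fitt₀(M) ⊆ (c)` and at every height-one prime `𝔭 = (π)` some `x = c·y ∈ Fitt₀(M)` has `y ∉ 𝔭`
(de Smit–Rubin–Schoof: `Fitt₀(M_𝔭) = 𝔭^{ℓ_𝔭(M)}` EXACTLY, and `π^{ℓ_𝔭(M)} ∣ c`); so the ideal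
`J = (Fitt₀(M) : c)` lies in no height-one prime, hence (as `dim 𝒪⟦T⟧ = 2`) in no prime other than
`𝔪 = (ϖ, T)`; if a prime `ℓ` of `𝒪'⟦T⟧` divided `φ(y)` for all `y ∈ J`, then `φ⁻¹(ℓ) ⊇ J` would be
`𝔪`, so `ℓ ∣ T` and `ℓ ∣ ι(ϖ)`, i.e. `T ∣ ι(ϖ) ≠ 0` — absurd; so for every prime `ℓ` some `y ∈ J`
has `ℓ ∤ φ(y)`, and `L ∣ φ(c)·φ(y)` for all such `y` forces `L ∣ φ(c)` (induction on the prime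
factorisation of `L` in the UFD `𝒪'⟦T⟧`).

## Contents

* §1 `exists_mem_fittingIdeal_zero_not_pow_succ_dvd` (local DRS equality, any Noetherian domain),
  `charIdeal_le_pow_lengthAt`, `exists_mul_mem_fittingIdeal_zero_not_mem` (Noetherian UFD).
* §2 `dvd_of_forall_dvd_of_forall_prime_exists` (UFD induction).
* §3 `ringKrullDim_powerSeries_eq_two` (`𝒪` a DVR), `eq_maximalIdeal_of_height_ne`.
* §4 `map_charIdeal_le_span_of_map_fittingIdeal_le` (the 𝔪^k-trick).
* The `hnf`-FREE twins of p470728 §1 ∕ §2 ∕ §4 (module, Selmer, crux level, `S = 𝒪'⟦T⟧`) are in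
  the sequel `ErratumRoadFiveIMCDivTransferTorsionOnly.lean`: Road FF then needs on `X_f` ONLY
  torsionness (at erratum data the tree THEOREM `controlUpperOnTreeAt_of_isErratumField` ⊢
  `XAc.HasCharValuationAt`, transported by F1).

References: [Castella2018Erratum] Lemma 2.2 and proof of Thm. 1.1 (p. 4); [Skinner2016PacificMC]
§2.3 (Lemma `F^Σ = Ch^Σ`), §3.1; [DeSmitRubinSchoof1997] §1; [StacksProject] Tags 07ZA, 07ZC, 00KD
(dimension of power series rings); [Greenberg2016] Prop. 4.1.1; [HatleyLei2019] Prop. 3.12.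
-/

noncomputable section

open scoped TensorProduct
open Literature.RingTheory.FittingIdeal Literature.NumberTheory.EllipticCurves
  Literature.NumberTheory.EllipticCurves.Module

namespace Summit.BirchSwinnertonDyer.Rank1Residual.X11b.CongruenceLimit

universe u

variable {R : Type u} [CommRing R]

/-! ### §1 The order ideal attains the local length at every height-one prime -/

section LocalDRS

variable [IsNoetherianRing R] [IsDomain R] {M : Type*} [AddCommGroup M] [Module R M]
  [Module.Finite R M]

/-- **The local equality of de Smit–Rubin–Schoof, contrapositive form**: for a finite module `M`
over a Noetherian domain and a nonzero principal prime `𝔭 = (π)` at which `M` has finite local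
length `n`, some `x ∈ Fitt₀(M)` is NOT divisible by `π^{n+1}` — since `Fitt₀(M)·R_𝔭 = Fitt₀(M_𝔭)
= 𝔭^n R_𝔭` exactly (`Module.fittingIdeal_zero_eq_maximalIdeal_pow`), not merely `⊆`.
[cite: DeSmitRubinSchoof1997, §1, p. 347] -/
theorem exists_mem_fittingIdeal_zero_not_pow_succ_dvd (𝔭 : PrimeSpectrum R) {π : R}
    (hπ𝔭 : 𝔭.asIdeal = Ideal.span {π}) (hπ : π ≠ 0) (hlen : lengthAt R M 𝔭 ≠ ⊤) :
    ∃ x ∈ Module.fittingIdeal R M 0, ¬ π ^ ((lengthAt R M 𝔭).toNat + 1) ∣ x := by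
  obtain ⟨hPID, hmax, hirr⟩ := isPrincipalIdealRing_localization_of_eq_span 𝔭.asIdeal hπ𝔭 hπ
  haveI : IsPrincipalIdealRing (Localization.AtPrime 𝔭.asIdeal) := hPID
  haveI : IsDiscreteValuationRing (Localization.AtPrime 𝔭.asIdeal) :=
    { not_a_field' := by
        rw [hmax, Ne, Ideal.span_singleton_eq_bot]
        exact hirr.ne_zero }
  obtain ⟨n, hn⟩ := ENat.ne_top_iff_exists.mp hlen
  have hlenMp : Module.length (Localization.AtPrime 𝔭.asIdeal)
      (LocalizedModule 𝔭.asIdeal.primeCompl M) = n := hn.symm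
  rw [← hn, ENat.toNat_coe]
  by_contra hall'
  have hall : ∀ x ∈ Module.fittingIdeal R M 0, π ^ (n + 1) ∣ x := fun x hx => by
    by_contra h
    exact hall' ⟨x, hx, h⟩
  set ϖ := algebraMap R (Localization.AtPrime 𝔭.asIdeal) π with hϖdef
  -- `Fitt₀(M_𝔭) = (ϖ^n)` and, by assumption, `⊆ (ϖ^{n+1})`
  have hFitt : Module.fittingIdeal (Localization.AtPrime 𝔭.asIdeal)
      (LocalizedModule 𝔭.asIdeal.primeCompl M) 0 = Ideal.span {ϖ ^ n} := by
    rw [Module.fittingIdeal_zero_eq_maximalIdeal_pow hlenMp, hmax, Ideal.span_singleton_pow]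
  have hle : Module.fittingIdeal (Localization.AtPrime 𝔭.asIdeal)
      (LocalizedModule 𝔭.asIdeal.primeCompl M) 0 ≤ Ideal.span {ϖ ^ (n + 1)} := by
    rw [Module.fittingIdeal_of_isLocalizedModule 𝔭.asIdeal.primeCompl
      (Localization.AtPrime 𝔭.asIdeal) (LocalizedModule.mkLinearMap 𝔭.asIdeal.primeCompl M) 0,
      Ideal.map_le_iff_le_comap]
    intro x hx
    rw [Ideal.mem_comap, Ideal.mem_span_singleton, hϖdef, ← map_pow]
    exact map_dvd _ (hall x hx)
  rw [hFitt, Ideal.span_singleton_le_span_singleton] at hle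
  have hk := (pow_dvd_pow_iff hirr.ne_zero hirr.not_isUnit).mp hle
  omega

end LocalDRS

section Global

variable [IsNoetherianRing R] [IsDomain R] [UniqueFactorizationMonoid R]
  {M : Type*} [AddCommGroup M] [Module R M] [Module.Finite R M]

omit [UniqueFactorizationMonoid R] in
/-- `char(M) ⊆ 𝔭^{ℓ_𝔭(M)}` for every height-one prime `𝔭` of a Noetherian domain and every finite
torsion `M` (the product defining `char` is finite and contains this factor, or the factor is
`1`). [cite: Washington1997, §13.2 (definition of the characteristic ideal)] -/
theorem charIdeal_le_pow_lengthAt (hM : Module.IsTorsion R M) (𝔭 : PrimeSpectrum R)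
    (h𝔭 : 𝔭.asIdeal.height = 1) :
    charIdeal R M ≤ 𝔭.asIdeal ^ (lengthAt R M 𝔭).toNat := by
  classical
  obtain ⟨s, hs, hs0⟩ := Submodule.exists_mem_ne_zero_of_ne_bot
    (annihilator_ne_bot_of_isTorsion M hM)
  have hsM : Module.IsTorsionBy R M s := fun m => Module.mem_annihilator.mp hs m
  have hfin := finite_heightOne_inter_mulSupport (M := M) hs0 hsM
  set t : Finset (PrimeSpectrum R) := hfin.toFinset with ht
  have hchar : charIdeal R M = ∏ 𝔭 ∈ t, 𝔭.asIdeal ^ (lengthAt R M 𝔭).toNat := by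
    unfold charIdeal
    apply finprod_mem_eq_prod_of_inter_mulSupport_eq
    rw [ht, Set.Finite.coe_toFinset, Set.inter_assoc, Set.inter_self]
  by_cases h𝔭t : 𝔭 ∈ t
  · rw [hchar]
    exact Ideal.prod_le_inf.trans (Finset.inf_le h𝔭t)
  · have h1 : 𝔭.asIdeal ^ (lengthAt R M 𝔭).toNat = 1 := by
      by_contra hne
      exact h𝔭t (by rw [ht, Set.Finite.mem_toFinset]; exact ⟨h𝔭, hne⟩)
    rw [h1, Ideal.one_eq_top]
    exact le_top

/-- **`(Fitt₀(M) : c)` lies in no height-one prime.** For a finite torsion `M` over a Noetherian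
UFD with `char(M) = (c)` and a height-one prime `𝔭`, some `y ∉ 𝔭` has `c·y ∈ Fitt₀(M)`:
`𝔭 = (π)` (`UniqueFactorizationMonoid.isPrincipal_of_height_eq_one`), `π^{ℓ_𝔭} ∣ c`
(`charIdeal_le_pow_lengthAt`), and some `x = c·y ∈ Fitt₀(M) ⊆ (c)` has `π^{ℓ_𝔭+1} ∤ x`
(`exists_mem_fittingIdeal_zero_not_pow_succ_dvd`). [cite: DeSmitRubinSchoof1997, §1, p. 347]
[cite: Skinner2016PacificMC, §2.3 (proof of the Lemma `F^Σ_L(f) = Ch^Σ_L(f)`)] -/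
theorem exists_mul_mem_fittingIdeal_zero_not_mem (hM : Module.IsTorsion R M) {c : R}
    (hc : charIdeal R M = Ideal.span {c}) (𝔭 : PrimeSpectrum R) (h𝔭 : 𝔭.asIdeal.height = 1) :
    ∃ y : R, c * y ∈ Module.fittingIdeal R M 0 ∧ y ∉ 𝔭.asIdeal := by
  obtain ⟨g, hg⟩ := UniqueFactorizationMonoid.isPrincipal_of_height_eq_one h𝔭
  have hπeq : 𝔭.asIdeal = Ideal.span {g} := by rw [hg, Ideal.submodule_span_eq]
  have hπ0 : g ≠ 0 := by
    rintro rfl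
    exact Ideal.ne_bot_of_height_eq_one h𝔭 (by rw [hπeq, Ideal.span_singleton_eq_bot])
  obtain ⟨s, hs, hs0⟩ := Submodule.exists_mem_ne_zero_of_ne_bot
    (annihilator_ne_bot_of_isTorsion M hM)
  have hsM : Module.IsTorsionBy R M s := fun m => Module.mem_annihilator.mp hs m
  have hlen := lengthAt_ne_top_of_isTorsionBy hs0 hsM 𝔭 h𝔭.le
  obtain ⟨x, hx, hndvd⟩ := exists_mem_fittingIdeal_zero_not_pow_succ_dvd 𝔭 hπeq hπ0 hlen
  have hxc : x ∈ Ideal.span {c} := hc ▸ fittingIdeal_zero_le_charIdeal hM hx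
  obtain ⟨y, hy⟩ := Ideal.mem_span_singleton'.mp hxc
  refine ⟨y, by rwa [mul_comm, hy], fun hy𝔭 => hndvd ?_⟩
  -- `g^{ℓ} ∣ c` and `g ∣ y` give `g^{ℓ+1} ∣ c·y = x`
  have hgc : g ^ (lengthAt R M 𝔭).toNat ∣ c := by
    have h := charIdeal_le_pow_lengthAt hM 𝔭 h𝔭
    rw [hc, hπeq, Ideal.span_singleton_pow, Ideal.span_singleton_le_span_singleton] at h
    exact h
  have hgy : g ∣ y := by
    rw [hπeq, Ideal.mem_span_singleton] at hy𝔭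
    exact hy𝔭
  rw [← hy, pow_succ, mul_comm y c]
  exact mul_dvd_mul hgc hgy

end Global

/-! ### §2 Divisibility from divisibility of multiples, in a UFD -/

section UFD

variable {S : Type*} [CommRing S] [IsDomain S] [UniqueFactorizationMonoid S]

/-- **`L ∣ c` from `L ∣ c·y` for enough `y`** (UFD induction): if `L` divides every element of a
set `F`, and for every prime `ℓ` some multiple `c·y ∈ F` has `ℓ ∤ y`, then `L ∣ c` — peel the
prime factors of `L` one at a time (`UniqueFactorizationMonoid.induction_on_prime`). The ring must
have at least one prime (for the case `L = 0`). [folklore] -/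
theorem dvd_of_forall_dvd_of_forall_prime_exists {F : Set S} {c L : S}
    (hF : ∀ x ∈ F, L ∣ x) (hgen : ∀ ℓ : S, Prime ℓ → ∃ y : S, c * y ∈ F ∧ ¬ ℓ ∣ y)
    (hS : ∃ ℓ : S, Prime ℓ) : L ∣ c := by
  revert hF
  refine UniqueFactorizationMonoid.induction_on_prime L ?_ ?_ ?_
  · intro hF
    obtain ⟨ℓ, hℓ⟩ := hS
    obtain ⟨y, hy, hndvd⟩ := hgen ℓ hℓ
    have h0 : c * y = 0 := zero_dvd_iff.mp (hF _ hy)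
    have hy0 : y ≠ 0 := fun h => hndvd (h ▸ dvd_zero ℓ)
    exact zero_dvd_iff.mpr ((mul_eq_zero.mp h0).resolve_right hy0)
  · intro x hx _
    exact hx.dvd
  · intro a ℓ ha hℓ ih hF
    have hF' : ∀ x ∈ F, a ∣ x := fun x hx => (dvd_mul_left a ℓ).trans (hF x hx)
    obtain ⟨d, hd⟩ := ih hF'
    obtain ⟨y, hy, hndvd⟩ := hgen ℓ hℓ
    have h1 : ℓ * a ∣ c * y := hF _ hy
    rw [hd, mul_assoc, mul_comm ℓ a] at h1
    have h2 : ℓ ∣ d * y := (mul_dvd_mul_iff_left ha).mp h1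
    obtain ⟨e, he⟩ := (hℓ.dvd_or_dvd h2).resolve_right hndvd
    exact ⟨e, by rw [hd, he]; ring⟩

end UFD

/-! ### §3 `dim 𝒪⟦T⟧ = 2`: the primes of `Λ_𝒪` are `0`, the height-one primes, and `𝔪` -/

section Dim

open PowerSeries IsLocalRing

variable (𝒪 : Type) [CommRing 𝒪] [IsDomain 𝒪] [IsDiscreteValuationRing 𝒪]

/-- **`dim 𝒪⟦T⟧ = 2` for a discrete valuation ring `𝒪`**: `T` is a regular element of the
Jacobson radical of the Noetherian local ring `𝒪⟦T⟧` with `𝒪⟦T⟧/(T) ≅ 𝒪` of dimension `1`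
(Mathlib: `ringKrullDim_quotient_span_singleton_succ_eq_ringKrullDim_of_mem_jacobson`,
`IsPrincipalIdealRing.ringKrullDim_eq_one`). [cite: StacksProject, Tag 00KD] -/
theorem ringKrullDim_powerSeries_eq_two : ringKrullDim 𝒪⟦X⟧ = 2 := by
  have hker : RingHom.ker (constantCoeff : 𝒪⟦X⟧ →+* 𝒪) = Ideal.span {X} := by
    ext f
    rw [RingHom.mem_ker, Ideal.mem_span_singleton, X_dvd_iff]
  have hsurj : Function.Surjective (constantCoeff : 𝒪⟦X⟧ →+* 𝒪) :=
    fun a => ⟨C a, constantCoeff_C a⟩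
  let e : (𝒪⟦X⟧ ⧸ Ideal.span {(X : 𝒪⟦X⟧)}) ≃+* 𝒪 :=
    (Ideal.quotEquivOfEq hker.symm).trans (RingHom.quotientKerEquivOfSurjective hsurj)
  have h1 : ringKrullDim (𝒪⟦X⟧ ⧸ Ideal.span {(X : 𝒪⟦X⟧)}) = 1 := by
    rw [ringKrullDim_eq_of_ringEquiv e]
    exact IsPrincipalIdealRing.ringKrullDim_eq_one 𝒪 (IsDiscreteValuationRing.not_isField 𝒪)
  have hreg : IsSMulRegular 𝒪⟦X⟧ (X : 𝒪⟦X⟧) := fun a b h => mul_left_cancel₀ X_ne_zero h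
  have hX : (X : 𝒪⟦X⟧) ∈ Ring.jacobson 𝒪⟦X⟧ := by
    rw [Ring.jacobson_eq_sInf_isMaximal]
    refine Ideal.mem_sInf.mpr fun {I} hI => ?_
    haveI : I.IsMaximal := hI
    rw [IsLocalRing.eq_maximalIdeal hI, IsLocalRing.mem_maximalIdeal, mem_nonunits_iff,
      isUnit_iff_constantCoeff, constantCoeff_X]
    exact not_isUnit_zero
  have h := ringKrullDim_quotient_span_singleton_succ_eq_ringKrullDim_of_mem_jacobson hreg hX
  rw [h1] at h
  rw [← h]
  exact one_add_one_eq_two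

/-- **In `𝒪⟦T⟧` (`𝒪` a DVR) a prime ideal of height neither `0` nor `1` is the maximal ideal**
(`dim 𝒪⟦T⟧ = 2`: a prime strictly below `𝔪` has height `≤ 1`). [cite: StacksProject, Tag 00KD] -/
theorem eq_maximalIdeal_of_height_ne {P : Ideal 𝒪⟦X⟧} [P.IsPrime] (h0 : P.height ≠ 0)
    (h1 : P.height ≠ 1) : P = maximalIdeal 𝒪⟦X⟧ := by
  by_contra hne
  have hlt : P < maximalIdeal 𝒪⟦X⟧ :=
    lt_of_le_of_ne (IsLocalRing.le_maximalIdeal (Ideal.IsPrime.ne_top ‹_›)) hne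
  have h2 := Ideal.height_add_one_le_of_lt_of_isPrime hlt
  have hm : (maximalIdeal 𝒪⟦X⟧).height = 2 := by
    have h := IsLocalRing.maximalIdeal_height_eq_ringKrullDim (R := 𝒪⟦X⟧)
    rw [ringKrullDim_powerSeries_eq_two, show (2 : WithBot ℕ∞) = ((2 : ℕ∞) : WithBot ℕ∞) from rfl,
      WithBot.coe_eq_coe] at h
    exact h
  rw [hm] at h2
  -- `P.height + 1 ≤ 2` in `ℕ∞` forces `P.height ∈ {0, 1}`
  induction hP : P.height using ENat.recTopCoe with
  | top => rw [hP] at h2; exact absurd h2 (by decide)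
  | coe k =>
    rw [hP] at h2 h0 h1
    have hk : k + 1 ≤ 2 := by exact_mod_cast h2
    have hk0 : k ≠ 0 := fun h => h0 (by rw [h]; rfl)
    have hk1 : k ≠ 1 := fun h => h1 (by rw [h]; rfl)
    omega

end Dim

/-! ### §4 The 𝔪^k-trick: `Fitt₀(M)·𝒪'⟦T⟧ ⊆ (L) ⟹ char(M)·𝒪'⟦T⟧ ⊆ (L)` for torsion `M` -/

section Main

open PowerSeries IsLocalRing

variable {𝒪 : Type} [CommRing 𝒪] [IsDomain 𝒪] [IsDiscreteValuationRing 𝒪]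
  {𝒪' : Type} [CommRing 𝒪'] [IsDomain 𝒪'] [IsPrincipalIdealRing 𝒪']
  {M : Type*} [AddCommGroup M] [Module 𝒪⟦X⟧ M] [Module.Finite 𝒪⟦X⟧ M]

/-- **The 𝔪^k-trick (no "Lemma 2.2").** `𝒪` a DVR, `𝒪'` a PID, `ι : 𝒪 → 𝒪'` injective,
`φ = 𝒪⟦T⟧ → 𝒪'⟦T⟧` the induced map, `M` a finite TORSION `𝒪⟦T⟧`-module, `L ∈ 𝒪'⟦T⟧`: if
`Fitt₀(M)·𝒪'⟦T⟧ ⊆ (L)` then `char(M)·𝒪'⟦T⟧ ⊆ (L)` — no hypothesis on finite submodules of `M`.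
See the module docstring for the proof. This replaces erratum Lemma 2.2 ∕ [Ski16, Prop. 2.3.3 (ii)]
in the one-sided transfer. [cite: Castella2018Erratum, proof of Thm. 1.1 (p. 4), "Ch = Fitt" step, here bypassed]
[cite: DeSmitRubinSchoof1997, §1] -/
theorem map_charIdeal_le_span_of_map_fittingIdeal_le (ι : 𝒪 →+* 𝒪') (hι : Function.Injective ι)
    (hM : Module.IsTorsion 𝒪⟦X⟧ M) {L : 𝒪'⟦X⟧}
    (hF : (Module.fittingIdeal 𝒪⟦X⟧ M 0).map (PowerSeries.map ι) ≤ Ideal.span {L}) :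
    (charIdeal 𝒪⟦X⟧ M).map (PowerSeries.map ι) ≤ Ideal.span {L} := by
  set φ : 𝒪⟦X⟧ →+* 𝒪'⟦X⟧ := PowerSeries.map ι with hφ
  haveI := charIdeal_isPrincipal' (R := 𝒪⟦X⟧) M
  set c : 𝒪⟦X⟧ := Submodule.IsPrincipal.generator (charIdeal 𝒪⟦X⟧ M) with hcdef
  have hc : charIdeal 𝒪⟦X⟧ M = Ideal.span {c} := (Ideal.span_singleton_generator _).symm
  suffices hdvd : L ∣ φ c by
    rw [hc, Ideal.map_span, Set.image_singleton]
    exact Ideal.span_singleton_le_span_singleton.mpr hdvd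
  refine dvd_of_forall_dvd_of_forall_prime_exists
    (F := φ '' (Module.fittingIdeal 𝒪⟦X⟧ M 0 : Set 𝒪⟦X⟧)) ?_ ?_ ⟨X, X_prime⟩
  · rintro _ ⟨x, hx, rfl⟩
    exact Ideal.mem_span_singleton.mp (hF (Ideal.mem_map_of_mem _ hx))
  · intro ℓ hℓ
    by_contra hno'
    have hno : ∀ y : 𝒪'⟦X⟧, φ c * y ∈ φ '' (Module.fittingIdeal 𝒪⟦X⟧ M 0 : Set 𝒪⟦X⟧) → ℓ ∣ y :=
      fun y hy => by
        by_contra h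
        exact hno' ⟨y, hy, h⟩
    -- `P = φ⁻¹(ℓ)` is a prime containing `J = (Fitt₀(M) : c)`
    haveI hℓP : (Ideal.span {ℓ}).IsPrime := (Ideal.span_singleton_prime hℓ.ne_zero).mpr hℓ
    set P : Ideal 𝒪⟦X⟧ := (Ideal.span {ℓ}).comap φ with hPdef
    haveI hP : P.IsPrime := Ideal.IsPrime.comap φ
    have hJP : ∀ y : 𝒪⟦X⟧, c * y ∈ Module.fittingIdeal 𝒪⟦X⟧ M 0 → y ∈ P := by
      intro y hy
      rw [hPdef, Ideal.mem_comap, Ideal.mem_span_singleton]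
      exact hno (φ y) ⟨c * y, hy, by rw [map_mul]⟩
    -- `P` has height neither `1` …
    have hP1 : P.height ≠ 1 := fun h1 => by
      obtain ⟨y, hy, hyP⟩ := exists_mul_mem_fittingIdeal_zero_not_mem hM hc ⟨P, hP⟩ h1
      exact hyP (hJP y hy)
    -- … nor `0` (`J ⊄ (T)` and `(T)` has height one, so `J ≠ 0`)
    haveI hXP : (Ideal.span {(X : 𝒪⟦X⟧)}).IsPrime :=
      (Ideal.span_singleton_prime X_ne_zero).mpr X_prime
    haveI hXpr : (Ideal.span {(X : 𝒪⟦X⟧)}).IsPrincipal := ⟨⟨X, rfl⟩⟩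
    have hX1 : (Ideal.span {(X : 𝒪⟦X⟧)}).height = 1 := by
      refine le_antisymm (Ideal.height_le_one_of_isPrincipal_of_mem_minimalPrimes
        (Ideal.span {(X : 𝒪⟦X⟧)}) _ ?_) ?_
      · rw [Ideal.minimalPrimes_eq_subsingleton_self]
        exact Set.mem_singleton _
      · rw [Order.one_le_iff_ne_zero, Ne, Ideal.height_eq_zero_iff_eq_bot,
          Ideal.span_singleton_eq_bot]
        exact X_ne_zero
    have hP0 : P.height ≠ 0 := by
      rw [Ne, Ideal.height_eq_zero_iff_eq_bot]
      intro hPbot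
      obtain ⟨y, hy, hyX⟩ :=
        exists_mul_mem_fittingIdeal_zero_not_mem hM hc ⟨Ideal.span {X}, hXP⟩ hX1
      have hyP : y ∈ P := hJP y hy
      rw [hPbot, Ideal.mem_bot] at hyP
      exact hyX (hyP ▸ Ideal.zero_mem _)
    -- so `P = 𝔪 ∋ T, ϖ`
    have hPm := eq_maximalIdeal_of_height_ne 𝒪 hP0 hP1
    obtain ⟨ϖ, hϖ⟩ := IsDiscreteValuationRing.exists_irreducible 𝒪
    have hXm : (X : 𝒪⟦X⟧) ∈ P := by
      rw [hPm, IsLocalRing.mem_maximalIdeal, mem_nonunits_iff, isUnit_iff_constantCoeff,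
        constantCoeff_X]
      exact not_isUnit_zero
    have hϖm : (C ϖ : 𝒪⟦X⟧) ∈ P := by
      rw [hPm, IsLocalRing.mem_maximalIdeal, mem_nonunits_iff, isUnit_iff_constantCoeff,
        constantCoeff_C]
      exact hϖ.not_isUnit
    rw [hPdef, Ideal.mem_comap, Ideal.mem_span_singleton] at hXm hϖm
    rw [hφ, map_X] at hXm
    rw [hφ, map_C] at hϖm
    -- `ℓ ~ T`, so `T ∣ ι(ϖ)`: absurd
    have hass : Associated ℓ X := hℓ.irreducible.associated_of_dvd X_prime.irreducible hXm
    have h3 : (X : 𝒪'⟦X⟧) ∣ C (ι ϖ) := hass.symm.dvd.trans hϖm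
    rw [X_dvd_iff, constantCoeff_C] at h3
    exact hϖ.ne_zero (hι (by rw [h3, map_zero]))

end Main

end Summit.BirchSwinnertonDyer.Rank1Residual.X11b.CongruenceLimit

end
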